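import Literature.Probability.RandomPlanarGeometry.HexSAWBrickWallStripFugacityWidthOneContactBoundaryLDP
import HarnessLib

/-!
# The LDP of the contact-density pair up to the boundary: positivity of the extended rate, the limit on open sets, exponential decay

Child module of `…ContactBoundaryLDP` (the LDP upper bound on compact subsets of the CLOSED density triangle `T̄` with the extended rate
`J̄_{y,z} = log μ₁(y,z) − a log y − a' log z − s̄`).  Here:
* §1 an open set inside `T̄` lies inside the open triangle `T`; the within-`T` neighbourhood filter of a point of `T̄` is non-trivial;
* §2 ★★ the SUPPORTING-PLANE INEQUALITY UP TO THE BOUNDARY: for `x ∈ T̄` and `(a,a') ∈ T`, `J̄(x) ≥ J̃(a,a') + ⟨θ_{(a,a')}, x − (a,a')⟩`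
  (limit of the interior inequality); ★★ hence `J̄ > 0` on `T̄` off the typical pair `b` (midpoint argument) — the extended rate has a
  UNIQUE ZERO on the closed triangle;
* §3 ★★★ THE LIMIT ON OPEN SETS WITH CLOSURE IN `T̄`: `G` open bounded nonempty, `cl G ⊆ T̄` ⇒ `lim (1/N) log P_N(G) = −min_{cl G} J̄ = −inf_G J̄`
  (e.g. `G = T ∩ B(x,r)` at a boundary point `x`);
* §4 ★★★ EXPONENTIAL DECAY on every compact `K ⊆ T̄` missing the typical pair: `P_N(K) ≤ e^{−cN}` eventually, `c = J̄(m)/2 > 0`.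
With #693/#707 (lower bound on open sets, upper bound inside `T`) this completes the large deviation principle of `(bc/N, tc/N)` on the closed
triangle with the good rate function `J̄_{y,z}`, continuous on `T̄`, strictly convex inside, vanishing only at `(b(y,z), b(z,y))`.

## Sources
DemboZeitouni2010 §1.2 (LDP, continuity sets, good rate functions) and §2.2 Theorem 2.2.30; JansevanRensburg2000 §3.3 (1st ed., OUP 2000).
Nothing quoted AS PRINTED; statements are this lineage's.
-/

noncomputable section

open Filter Topology Finset Literature.Probability.LatticeModels Literature.Probability.Percolation SimpleGraph

namespace Literature.Probability.RandomPlanarGeometry.SAW.HexBW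

open WidthOneYZ Real

variable {y z : ℝ}

/-! ## §1 Open subsets of the closed triangle; the within filter -/

/-- A point of an OPEN set contained in the closed triangle lies in the open triangle. [cite: DemboZeitouni2010, §1.2 (lane plumbing)] -/
theorem mem_triangle_of_isOpen_subset_closed {G : Set (ℝ × ℝ)} (hG : IsOpen G)
    (hGT : G ⊆ {p : ℝ × ℝ | p.1 + p.2 ≤ 1 / 2 ∧ 1 ≤ 4 * p.1 + 2 * p.2 ∧ 1 ≤ 2 * p.1 + 4 * p.2}) {p : ℝ × ℝ} (hp : p ∈ G) :
    p.1 + p.2 < 1 / 2 ∧ 1 < 4 * p.1 + 2 * p.2 ∧ 1 < 2 * p.1 + 4 * p.2 := by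
  obtain ⟨r, hr0, hball⟩ := Metric.isOpen_iff.1 hG p hp
  have hr2 : 0 < r / 2 := by linarith
  -- three probes: `p + (r/2)(1,0)`-type moves leave `T̄` unless the constraint is strict
  have m1 : ((p.1 + r / 2, p.2) : ℝ × ℝ) ∈ G := by
    apply hball; rw [Metric.mem_ball, Prod.dist_eq, Real.dist_eq, Real.dist_eq]
    simp only [add_sub_cancel_left, sub_self, abs_zero, abs_of_pos hr2]
    exact max_lt (by linarith) hr0
  have m2 : ((p.1 - r / 2, p.2) : ℝ × ℝ) ∈ G := by
    apply hball; rw [Metric.mem_ball, Prod.dist_eq, Real.dist_eq, Real.dist_eq]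
    simp only [sub_sub_cancel_left, abs_neg, sub_self, abs_zero, abs_of_pos hr2]
    exact max_lt (by linarith) hr0
  have m3 : ((p.1, p.2 - r / 2) : ℝ × ℝ) ∈ G := by
    apply hball; rw [Metric.mem_ball, Prod.dist_eq, Real.dist_eq, Real.dist_eq]
    simp only [sub_self, abs_zero, sub_sub_cancel_left, abs_neg, abs_of_pos hr2]
    exact max_lt hr0 (by linarith)
  obtain ⟨a1, -, -⟩ := hGT m1
  obtain ⟨-, a2, -⟩ := hGT m2
  obtain ⟨-, -, a3⟩ := hGT m3
  simp only at a1 a2 a3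
  exact ⟨by linarith, by linarith, by linarith⟩

/-- Every point of the closed triangle is in the closure of the open one: the within-`T` neighbourhood filter is non-trivial
(the segment to the centroid). [cite: DemboZeitouni2010, §1.2 (lane plumbing)] -/
theorem nhdsWithin_triangle_neBot {x₁ x₂ : ℝ} (h1 : x₁ + x₂ ≤ 1 / 2) (h2 : 1 ≤ 4 * x₁ + 2 * x₂) (h3 : 1 ≤ 2 * x₁ + 4 * x₂) :
    (𝓝[{p : ℝ × ℝ | p.1 + p.2 < 1 / 2 ∧ 1 < 4 * p.1 + 2 * p.2 ∧ 1 < 2 * p.1 + 4 * p.2}] ((x₁, x₂) : ℝ × ℝ)).NeBot := by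
  refine mem_closure_iff_nhdsWithin_neBot.1 ?_
  rw [Metric.mem_closure_iff]
  intro ε hε
  set t := min (1 / 2 : ℝ) (ε / 2) with ht
  have ht0 : 0 < t := lt_min (by norm_num) (by linarith)
  have ht1 : t ≤ 1 / 2 := min_le_left _ _
  have htε : t ≤ ε / 2 := min_le_right _ _
  refine ⟨(x₁ + t * (2 / 9 - x₁), x₂ + t * (2 / 9 - x₂)), segment_mem_triangle h1 h2 h3 ht0 (by linarith), ?_⟩
  rw [Prod.dist_eq, Real.dist_eq, Real.dist_eq]
  have b1 : |x₁ - (x₁ + t * (2 / 9 - x₁))| < ε := by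
    rw [show x₁ - (x₁ + t * (2 / 9 - x₁)) = -(t * (2 / 9 - x₁)) by ring, abs_neg, abs_mul, abs_of_pos ht0]
    have : |2 / 9 - x₁| ≤ 1 := by rw [abs_le]; constructor <;> linarith
    nlinarith
  have b2 : |x₂ - (x₂ + t * (2 / 9 - x₂))| < ε := by
    rw [show x₂ - (x₂ + t * (2 / 9 - x₂)) = -(t * (2 / 9 - x₂)) by ring, abs_neg, abs_mul, abs_of_pos ht0]
    have : |2 / 9 - x₂| ≤ 1 := by rw [abs_le]; constructor <;> linarith
    nlinarith
  exact max_lt b1 b2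

/-! ## §2 The supporting plane up to the boundary; the extended rate is positive off the typical pair -/

/-- ★★ **SUPPORTING PLANE UP TO THE BOUNDARY**: for `y, z > 0`, `x ∈ T̄` and `(a,a') ∈ T`,
`J̃(a,a') + log(Y(a,a')/y)(x₁ − a) + log(Y(a',a)/z)(x₂ − a') ≤ J̄(x)` — the affine minorant of the rate at an interior pair stays below the
extended rate on the closed triangle (the interior inequality `tilt_inner_le_jointRate_sub` passed to the limit along `T`).
[cite: DemboZeitouni2010, §2.2 (convexity of the Fenchel–Legendre transform; lane statement); JansevanRensburg2000, §3.3 (1st ed.)] -/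
theorem tilt_inner_le_rateExt_sub (hy : 0 < y) (hz : 0 < z) {a a' x₁ x₂ : ℝ} (k1 : a + a' < 1 / 2) (k2 : 1 < 4 * a + 2 * a')
    (k3 : 1 < 2 * a + 4 * a') (h1 : x₁ + x₂ ≤ 1 / 2) (h2 : 1 ≤ 4 * x₁ + 2 * x₂) (h3 : 1 ≤ 2 * x₁ + 4 * x₂) :
    jointRate y z (eosY a a') (eosY a' a) + Real.log (eosY a a' / y) * (x₁ - a) + Real.log (eosY a' a / z) * (x₂ - a') ≤
      Real.log (stripMuY₂ 1 y z) - x₁ * Real.log y - x₂ * Real.log z -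
        (negMulLog (1 - 2 * x₁ - 2 * x₂) +
          (negMulLog (4 * x₁ + 2 * x₂ - 1) + negMulLog (2 * x₁ + 4 * x₂ - 1) - negMulLog (2 * x₁) - negMulLog (2 * x₂)) / 2) := by
  haveI := nhdsWithin_triangle_neBot h1 h2 h3
  -- the extended rate is the within-`T` limit of `J̃`
  have hJ : Tendsto (fun p : ℝ × ℝ => Real.log (stripMuY₂ 1 y z) - p.1 * Real.log y - p.2 * Real.log z -
      (negMulLog (1 - 2 * p.1 - 2 * p.2) +
        (negMulLog (4 * p.1 + 2 * p.2 - 1) + negMulLog (2 * p.1 + 4 * p.2 - 1) - negMulLog (2 * p.1) - negMulLog (2 * p.2)) / 2))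
      (𝓝[{p : ℝ × ℝ | p.1 + p.2 < 1 / 2 ∧ 1 < 4 * p.1 + 2 * p.2 ∧ 1 < 2 * p.1 + 4 * p.2}] ((x₁, x₂) : ℝ × ℝ))
      (𝓝 (Real.log (stripMuY₂ 1 y z) - x₁ * Real.log y - x₂ * Real.log z -
        (negMulLog (1 - 2 * x₁ - 2 * x₂) +
          (negMulLog (4 * x₁ + 2 * x₂ - 1) + negMulLog (2 * x₁ + 4 * x₂ - 1) - negMulLog (2 * x₁) - negMulLog (2 * x₂)) / 2))) :=
    ((continuous_rateExt y z).tendsto (x₁, x₂)).mono_left nhdsWithin_le_nhds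
  -- subtract the affine part and compare on `T`
  have hlin : Tendsto (fun p : ℝ × ℝ => Real.log (eosY a a' / y) * (p.1 - a) + Real.log (eosY a' a / z) * (p.2 - a'))
      (𝓝[{p : ℝ × ℝ | p.1 + p.2 < 1 / 2 ∧ 1 < 4 * p.1 + 2 * p.2 ∧ 1 < 2 * p.1 + 4 * p.2}] ((x₁, x₂) : ℝ × ℝ))
      (𝓝 (Real.log (eosY a a' / y) * (x₁ - a) + Real.log (eosY a' a / z) * (x₂ - a'))) := by
    have hc : Continuous (fun p : ℝ × ℝ => Real.log (eosY a a' / y) * (p.1 - a) + Real.log (eosY a' a / z) * (p.2 - a')) := by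
      fun_prop
    exact (hc.tendsto (x₁, x₂)).mono_left nhdsWithin_le_nhds
  have hev : ∀ᶠ p : ℝ × ℝ in 𝓝[{p : ℝ × ℝ | p.1 + p.2 < 1 / 2 ∧ 1 < 4 * p.1 + 2 * p.2 ∧ 1 < 2 * p.1 + 4 * p.2}] ((x₁, x₂) : ℝ × ℝ),
      jointRate y z (eosY a a') (eosY a' a) + (Real.log (eosY a a' / y) * (p.1 - a) + Real.log (eosY a' a / z) * (p.2 - a')) ≤
        Real.log (stripMuY₂ 1 y z) - p.1 * Real.log y - p.2 * Real.log z -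
          (negMulLog (1 - 2 * p.1 - 2 * p.2) +
            (negMulLog (4 * p.1 + 2 * p.2 - 1) + negMulLog (2 * p.1 + 4 * p.2 - 1) - negMulLog (2 * p.1) - negMulLog (2 * p.2)) / 2) := by
    refine eventually_nhdsWithin_of_forall fun p hp => ?_
    obtain ⟨t1, t2, t3⟩ := hp
    have h := tilt_inner_le_jointRate_sub hy hz k1 k2 k3 t1 t2 t3
    rw [jointRate_eosY_eq_ext hy hz t1 t2 t3] at h
    linarith
  have hlim := le_of_tendsto_of_tendsto (tendsto_const_nhds.add hlin) hJ hev
  linarith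

/-- ★★ **THE EXTENDED RATE IS POSITIVE OFF THE TYPICAL PAIR, UP TO THE BOUNDARY**: for `y, z > 0` and `x ∈ T̄` with `x ≠ (b(y,z), b(z,y))`,
`J̄_{y,z}(x) > 0` — by the supporting planes at the midpoint `m` of `x` and the typical pair `b` (an interior pair ≠ `b`):
`J̄(x) + J̃(b) ≥ 2 J̃(m) > 0`.  So `J̄` has a UNIQUE zero on the closed triangle.
[cite: DemboZeitouni2010, §2.2 (good rate function with a unique zero; lane statement); JansevanRensburg2000, §3.3 (1st ed.)] -/
theorem rateExt_pos_of_ne (hy : 0 < y) (hz : 0 < z) {x₁ x₂ : ℝ} (h1 : x₁ + x₂ ≤ 1 / 2) (h2 : 1 ≤ 4 * x₁ + 2 * x₂)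
    (h3 : 1 ≤ 2 * x₁ + 4 * x₂) (hne : (x₁, x₂) ≠ (contactB y z, contactB z y)) :
    0 < Real.log (stripMuY₂ 1 y z) - x₁ * Real.log y - x₂ * Real.log z -
        (negMulLog (1 - 2 * x₁ - 2 * x₂) +
          (negMulLog (4 * x₁ + 2 * x₂ - 1) + negMulLog (2 * x₁ + 4 * x₂ - 1) - negMulLog (2 * x₁) - negMulLog (2 * x₂)) / 2) := by
  obtain ⟨t1, t2, t3⟩ := contactB_mem_triangle hy hz
  obtain ⟨eY, eZ⟩ := eosY_contactB hy hz
  set b := contactB y z with hb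
  set b' := contactB z y with hb'
  -- the midpoint is an interior pair, different from `b`
  have m1 : (x₁ + b) / 2 + (x₂ + b') / 2 < 1 / 2 := by linarith
  have m2 : 1 < 4 * ((x₁ + b) / 2) + 2 * ((x₂ + b') / 2) := by linarith
  have m3 : 1 < 2 * ((x₁ + b) / 2) + 4 * ((x₂ + b') / 2) := by linarith
  have hmne : (((x₁ + b) / 2, (x₂ + b') / 2) : ℝ × ℝ) ≠ (b, b') := by
    intro h
    apply hne
    have e1 := (Prod.mk.inj h).1
    have e2 := (Prod.mk.inj h).2
    ext <;> simp only <;> linarith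
  have hpos := jointRate_eosY_pos_of_ne hy hz m1 m2 m3 hmne
  -- supporting planes at the midpoint, towards `x` (closed version) and towards `b` (interior version)
  have hx := tilt_inner_le_rateExt_sub hy hz m1 m2 m3 h1 h2 h3
  have hbb := tilt_inner_le_jointRate_sub hy hz m1 m2 m3 t1 t2 t3
  rw [eY, eZ, jointRate_self hy hz] at hbb
  have e1 : b - (x₁ + b) / 2 = -(x₁ - (x₁ + b) / 2) := by ring
  have e2 : b' - (x₂ + b') / 2 = -(x₂ - (x₂ + b') / 2) := by ring
  rw [e1, e2] at hbb
  nlinarith [hx, hbb, hpos]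

/-! ## §3 The LDP limit on open sets with closure in the closed triangle -/

open Classical in
/-- ★★★ **THE LARGE DEVIATION LIMIT UP TO THE BOUNDARY**: for `y, z > 0` and a nonempty bounded open `G` whose closure lies in the CLOSED
density triangle (e.g. `G = T ∩ B(x,r)` for a boundary point `x`), there is a minimiser `m ∈ cl G` of the extended rate `J̄_{y,z}` with
`lim_{N→∞} (1/N) log P_{N,y,z}((bc/N, tc/N) ∈ G) = −J̄_{y,z}(m)` (upper: `ldp_upper_compact_closed`; lower: a point of `G ⊆ T` near `m`, #693).
[cite: DemboZeitouni2010, §1.2 (the LDP; continuity sets) and §2.2 Theorem 2.2.30; JansevanRensburg2000, §3.3 (1st ed.; lane statement)] -/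
theorem ldp_limit_open_closed (hy : 0 < y) (hz : 0 < z) {G : Set (ℝ × ℝ)} (hGo : IsOpen G) (hne : G.Nonempty)
    (hbd : Bornology.IsBounded G)
    (hGT : closure G ⊆ {p : ℝ × ℝ | p.1 + p.2 ≤ 1 / 2 ∧ 1 ≤ 4 * p.1 + 2 * p.2 ∧ 1 ≤ 2 * p.1 + 4 * p.2}) :
    ∃ m ∈ closure G, IsMinOn (fun p : ℝ × ℝ => Real.log (stripMuY₂ 1 y z) - p.1 * Real.log y - p.2 * Real.log z -
      (negMulLog (1 - 2 * p.1 - 2 * p.2) +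
        (negMulLog (4 * p.1 + 2 * p.2 - 1) + negMulLog (2 * p.1 + 4 * p.2 - 1) - negMulLog (2 * p.1) - negMulLog (2 * p.2)) / 2))
        (closure G) m ∧
      Tendsto (fun N : ℕ => Real.log ((∑ q ∈ (stripPairs 1 N).filter (fun q =>
          (((bottomVisits₀ q.1 q.2 N : ℝ) / N, (topVisits₀ 1 q.1 q.2 N : ℝ) / N) : ℝ × ℝ) ∈ G), wgt y z N q) / stripZ₂ 1 N y z) / N)
        atTop (𝓝 (-(Real.log (stripMuY₂ 1 y z) - m.1 * Real.log y - m.2 * Real.log z -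
          (negMulLog (1 - 2 * m.1 - 2 * m.2) +
            (negMulLog (4 * m.1 + 2 * m.2 - 1) + negMulLog (2 * m.1 + 4 * m.2 - 1) - negMulLog (2 * m.1) - negMulLog (2 * m.2)) / 2)))) := by
  set J : ℝ × ℝ → ℝ := fun p => Real.log (stripMuY₂ 1 y z) - p.1 * Real.log y - p.2 * Real.log z -
      (negMulLog (1 - 2 * p.1 - 2 * p.2) +
        (negMulLog (4 * p.1 + 2 * p.2 - 1) + negMulLog (2 * p.1 + 4 * p.2 - 1) - negMulLog (2 * p.1) - negMulLog (2 * p.2)) / 2)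
    with hJdef
  have hJc : Continuous J := continuous_rateExt y z
  have hK : IsCompact (closure G) := hbd.isCompact_closure
  have hKne : (closure G).Nonempty := hne.mono subset_closure
  obtain ⟨m, hm, hmin, hup⟩ := ldp_upper_compact_closed hy hz hK hKne hGT
  refine ⟨m, hm, hmin, ?_⟩
  have hGT' : G ⊆ {p : ℝ × ℝ | p.1 + p.2 ≤ 1 / 2 ∧ 1 ≤ 4 * p.1 + 2 * p.2 ∧ 1 ≤ 2 * p.1 + 4 * p.2} := subset_closure.trans hGT
  refine tendsto_log_div_of_exp_bounds (fun ε hε => ?_) (fun ε hε => ?_)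
  · -- lower bound: a point of `G` (hence of `T`) near `m` with `J̄ < J̄(m) + ε/2`
    have hε2 : 0 < ε / 2 := by linarith
    have hlt : J m < J m + ε / 2 := by linarith
    have hev := (hJc.continuousAt (x := m)).eventually (gt_mem_nhds hlt)
    obtain ⟨U, hU, hUo, hmU⟩ := mem_nhds_iff.1 hev
    obtain ⟨p, hpU, hpG⟩ : (U ∩ G).Nonempty := mem_closure_iff.1 hm U hUo hmU
    have hpJ : J p < J m + ε / 2 := hU hpU
    obtain ⟨s1, s2, s3⟩ := mem_triangle_of_isOpen_subset_closed hGo hGT' hpG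
    have hpG' : (p.1, p.2) ∈ G := hpG
    have hJp : jointRate y z (eosY p.1 p.2) (eosY p.2 p.1) = J p := by
      rw [hJdef]; simp only; exact jointRate_eosY_eq_ext hy hz s1 s2 s3
    filter_upwards [ldp_lower_open hy hz hGo hpG' s1 s2 s3 hε2] with N hN
    refine le_trans (Real.exp_le_exp.2 (mul_le_mul_of_nonneg_right ?_ (Nat.cast_nonneg N))) hN
    rw [hJp]
    simp only [hJdef] at hpJ ⊢
    linarith
  · -- upper bound: `G ⊆ closure G`
    filter_upwards [hup hε] with N hN
    refine le_trans ?_ hN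
    refine div_le_div_of_nonneg_right ?_ (stripZ₂_pos 1 N hy hz).le
    refine Finset.sum_le_sum_of_subset_of_nonneg (fun q hq => ?_) fun q _ _ => wgt_nonneg hy.le hz.le N q
    rw [Finset.mem_filter] at hq ⊢
    exact ⟨hq.1, subset_closure hq.2⟩

/-! ## §4 Exponential decay off the typical pair, up to the boundary -/

open Classical in
/-- ★★★ **EXPONENTIAL DECAY ON COMPACT SUBSETS OF THE CLOSED TRIANGLE MISSING THE TYPICAL PAIR**: for `y, z > 0` and a compact
`K ⊆ T̄` with `(b(y,z), b(z,y)) ∉ K` there is `c > 0` (half the minimum of `J̄` over `K`, positive by `rateExt_pos_of_ne`) with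
`P_{N,y,z}((bc/N, tc/N) ∈ K) ≤ exp(−cN)` eventually — e.g. the walks whose contact densities stay near a vertex or an edge of the triangle.
[cite: DemboZeitouni2010, §1.2 and §2.2 Theorem 2.2.30 (lane statement); JansevanRensburg2000, §3.3 (1st ed.)] -/
theorem eventually_fraction_compact_closed_le_exp_neg (hy : 0 < y) (hz : 0 < z) {K : Set (ℝ × ℝ)} (hK : IsCompact K)
    (hKT : K ⊆ {p : ℝ × ℝ | p.1 + p.2 ≤ 1 / 2 ∧ 1 ≤ 4 * p.1 + 2 * p.2 ∧ 1 ≤ 2 * p.1 + 4 * p.2})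
    (hmiss : ((contactB y z, contactB z y) : ℝ × ℝ) ∉ K) :
    ∃ c : ℝ, 0 < c ∧ ∀ᶠ N : ℕ in atTop,
      (∑ q ∈ (stripPairs 1 N).filter (fun q =>
        (((bottomVisits₀ q.1 q.2 N : ℝ) / N, (topVisits₀ 1 q.1 q.2 N : ℝ) / N) : ℝ × ℝ) ∈ K), wgt y z N q) / stripZ₂ 1 N y z ≤
        Real.exp (-(c * N)) := by
  by_cases hne : K.Nonempty
  · obtain ⟨m, hm, -, hup⟩ := ldp_upper_compact_closed hy hz hK hne hKT
    obtain ⟨t1, t2, t3⟩ := hKT hm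
    have hmne : ((m.1, m.2) : ℝ × ℝ) ≠ (contactB y z, contactB z y) := by
      intro h; exact hmiss (by rw [← h]; exact hm)
    have hpos := rateExt_pos_of_ne hy hz t1 t2 t3 hmne
    set Jm := Real.log (stripMuY₂ 1 y z) - m.1 * Real.log y - m.2 * Real.log z -
        (negMulLog (1 - 2 * m.1 - 2 * m.2) +
          (negMulLog (4 * m.1 + 2 * m.2 - 1) + negMulLog (2 * m.1 + 4 * m.2 - 1) - negMulLog (2 * m.1) - negMulLog (2 * m.2)) / 2)
      with hJm
    refine ⟨Jm / 2, by linarith, ?_⟩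
    filter_upwards [hup (show 0 < Jm / 2 by linarith)] with N hN
    refine hN.trans (le_of_eq ?_)
    congr 1; ring
  · refine ⟨1, one_pos, Filter.Eventually.of_forall fun N => ?_⟩
    have hempty : (stripPairs 1 N).filter (fun q =>
        (((bottomVisits₀ q.1 q.2 N : ℝ) / N, (topVisits₀ 1 q.1 q.2 N : ℝ) / N) : ℝ × ℝ) ∈ K) = ∅ :=
      Finset.filter_eq_empty_iff.2 fun q _ hq => hne ⟨_, hq⟩
    rw [hempty, Finset.sum_empty, zero_div]
    exact (Real.exp_pos _).le

end Literature.Probability.RandomPlanarGeometry.SAW.HexBW
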